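import Mathlib
import HarnessLib
import Summits.HubbardSuperconductivity.HubbardSuperconductivity.Theorems.KLProgrammeKLRegimeEngineV8GridLiterals

/-!
# Route `KLProgramme` — ENGINE child gen 8 (stmt-HubbardSuperconductivity-20437 `KLRegimeEngineV17F2`), located risk #9 (T′-B) literals: the FRAME-ZERO
# literals sit under the base literals — `2¹⁰·e¹⁸·κ₀⁴·klE3A1 R ≤ klZt0 R`, `2¹¹·e¹⁸·κ₀⁴·klE3A1 R ≤ klZs20 R` — so §C's n = 0 conjunct
# (`twoLegGridFlowMomentsAtC_zero_klE3A1 … |>.mono`) is one line once `klZt P R ≥ klZt0 R`, `klZs2 P R ≥ klZs20 R` (part 2 of the literal module)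

Cell gate-hubbard-kl, seat hubbard-kl-k3c2-p1 g8.  `klZt0 R = 4e²A²·klE3A1 R` with `A = klFrameA R = 4e⁴κ_R + 16e⁸κ₀² ≥ 16e⁸κ₀²` (`κ_R ≥ 0` under `R.WF`),
hence `klZt0 R ≥ 4e²·(16e⁸κ₀²)²·klE3A1 R = 2¹⁰e¹⁸κ₀⁴·klE3A1 R` — r2d-p1's frame-zero literal (p557865/…ExportGridC `twoLegGridFlowMomentsAtC_zero_klE3A1`);
likewise `klZs20 R = 2·klZt0 R ≥ 2¹¹e¹⁸κ₀⁴·klE3A1 R`.  Proofs only; no definitions; nothing about the model is asserted; nothing asserts superconductivity.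
`--supports stmt-HubbardSuperconductivity-20437`.  [cite: BenfattoGiulianiMastropietro2006, §3 (3.2)-(3.8)]
-/

noncomputable section

namespace Summit.HubbardSuperconductivity.HubbardSuperconductivity.Theorems.EngineV8

set_option linter.dupNamespace false -- summit = problem name (single-conjunct summit), D-0017

open Real Finset Literature.MathematicalPhysics.QuantumLattice Literature.Probability.LatticeModels
open Summit.HubbardSuperconductivity.HubbardSuperconductivity.Theorems.KLRegimeSplit
open Summit.HubbardSuperconductivity.HubbardSuperconductivity.Theorems.KLProgrammeLegKernels

/-- `16e⁸κ₀² ≤ klFrameA R` under `R.WF` (`κ_R ≥ 0`). -/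
theorem sixteen_mul_exp_pow_mul_kappa0_sq_le_klFrameA {R : RenConsts} (hR : R.WF) :
    16 * Real.exp 1 ^ 8 * Real.sqrt (2 * (7 + 1606732)) ^ 2 ≤ klFrameA R := by
  have hK := klFrameKR_nonneg hR
  unfold klFrameA
  have : 0 ≤ 4 * Real.exp 1 ^ 4 * klFrameKR R := by positivity
  linarith

/-- **The frame-zero TIME literal sits under the base literal**: `2¹⁰·e¹⁸·κ₀⁴·klE3A1 R ≤ klZt0 R`. -/
theorem frameZeroZt_le_klZt0 {R : RenConsts} (hR : R.WF) :
    (2 : ℝ) ^ 10 * Real.exp 1 ^ 18 * Real.sqrt (2 * (7 + 1606732)) ^ 4 * klE3A1 R ≤ klZt0 R := by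
  have hA := sixteen_mul_exp_pow_mul_kappa0_sq_le_klFrameA hR
  have hB0 : 0 ≤ 16 * Real.exp 1 ^ 8 * Real.sqrt (2 * (7 + 1606732)) ^ 2 := by positivity
  have hA2 : (16 * Real.exp 1 ^ 8 * Real.sqrt (2 * (7 + 1606732)) ^ 2) ^ 2 ≤ klFrameA R ^ 2 := pow_le_pow_left₀ hB0 hA 2
  have hE := (klE3A1_pos R).le
  have he2 : 0 ≤ 4 * Real.exp 1 ^ 2 := by positivity
  calc (2 : ℝ) ^ 10 * Real.exp 1 ^ 18 * Real.sqrt (2 * (7 + 1606732)) ^ 4 * klE3A1 R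
      = 4 * Real.exp 1 ^ 2 * (16 * Real.exp 1 ^ 8 * Real.sqrt (2 * (7 + 1606732)) ^ 2) ^ 2 * klE3A1 R := by ring
    _ ≤ 4 * Real.exp 1 ^ 2 * klFrameA R ^ 2 * klE3A1 R :=
        mul_le_mul_of_nonneg_right (mul_le_mul_of_nonneg_left hA2 he2) hE
    _ = klZt0 R := by unfold klZt0; ring

/-- **The frame-zero SPACE literal sits under the base `U²`-share literal**: `2¹¹·e¹⁸·κ₀⁴·klE3A1 R ≤ klZs20 R`. -/
theorem frameZeroZs_le_klZs20 {R : RenConsts} (hR : R.WF) :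
    (2 : ℝ) ^ 11 * Real.exp 1 ^ 18 * Real.sqrt (2 * (7 + 1606732)) ^ 4 * klE3A1 R ≤ klZs20 R := by
  have h := frameZeroZt_le_klZt0 hR
  rw [klZs20_eq_two_mul_klZt0]
  linarith

end Summit.HubbardSuperconductivity.HubbardSuperconductivity.Theorems.EngineV8

end
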